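import Summits.QuantumFields.BalabanUV.T4Continuum.Support.NE3LocalCrudeWindow
import Summits.QuantumFields.BalabanUV.T4Continuum.Support.NE3LocalReadoutSharp
import Summits.QuantumFields.BalabanUV.T4Continuum.Support.NE3EnergyWeightedShapes
import HarnessLib

/-!
# T⁴ programme, node NE3 — the LOCAL half, reading (D), crude fixed-torus route IN THE η-WEIGHTED CURRENCY (D-CRUDE-w),
# part 1: the two-level window read-out with the SHARP second-order bracket and a sup bound on the direction, against the
# weighted energy norm `energyNormW`

NE3 prover lineage P1, gen 20 (cell `pub-balaban`, unit `b2b-balaban-t4-ne3-p1`, row NE3 OWNER).  CONTEXT (skeleton v1.9 §4b,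
located error G-ne3p1-g19-1): the crude (D) END of gen 18 (`NE3LocalCrudeEnd.localRate_crude_of_energyRate`) consumes P2's root
T-E in the UNIT-SCALE energy norm, whose road is closed (kernel no-go `NE3TangentNoGo`).  The surviving variant (R3) lives in the
η-weighted currency `NE3EnergyWeightedShapes.energyNormW L k W Z F = √(curlSq + (L^k)⁻²·dirSq)`, in which the bond term `dirSq`
does NOT decay by itself.  The gen-18 bracket `(7/2)·Σ bondSq` of `NE3LocalReadouts.abs_fineAction_vary_sub_le` is then useless;
what decays is the curl, the plaquette radius of the background, and the SUP of the direction.  THIS FILE re-derives parts 1–2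
of the crude route ((51S) `NE3LocalCrudePair`, (52S) `NE3LocalCrudeWindow`) with the sharp read-out
`NE3LocalReadoutSharp.abs_fineAction_vary_sub_le_sharp` (gen 19, E-READOUT♯) and a sup bound `‖Z(b)‖ ≤ α`:

* §1 `Real.exp α − 1 ≤ α·e^α` and the closed majorant of the sharp bracket's coefficient:
  `144(e^α−1)² + 84α(e^α−1) ≤ 228·α²·(e^α)²`;
* §2 **`abs_fineAction_vary_sub_le_closed`**: for unitary `V` with plaquettes within `a` of `1` on the window, skew `X` with
  `‖X(b)‖ ≤ α`: `|A_W(V e^X) − A_W(V)| ≤ a·Σ‖d_V X‖ + Σ‖d_V X‖² + (7a/2 + 14α + 228α²(e^α)²)·Σ bondSq X`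
  (`bondL1² ≤ 4·bondSq`, `‖(d_V X)(p)‖ ≤ bondL1 ≤ 4α`);
* §3 **`abs_windowAction_sub_le_sharp'`**: the (D) identity of (51S) (`windowAction_sub_eq'`) + the β′-loc deficit bound + §2;
* §4 the direction terms against the WEIGHTED norm `E_w = energyNormW L k W Z (periodBox M)`: `Σ_Y‖d_W Z‖ ≤ √(#Y·#Pl)·E_w`,
  `Σ_Y‖d_W Z‖² ≤ E_w²`, `Σ_Y bondSq ≤ 4#Pl·(L^k)²·E_w²` — **`dirTermsW_le`**;
* §5 **`abs_windowAction_sub_le_of_regularSup_sharp`**: the twin of (52S) `abs_windowAction_sub_le_of_regularSup` — all inputs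
  named (`RegularSup` of `U_B`, the pair `(u, Z)`, the sup bound `α`), output in `E_w`.

HONEST FRAMING.  Elementary bookkeeping on ONE window in OUR repaired frame; nothing about minimisers is used beyond the displayed
hypotheses; T-E_w, (ML_w), (RES♯), the sup conjunct and (H∃) are NOT touched here; NE3 NOT proved; spine PROVED 0∕9; finite T⁴
rung (B)+1 — NOT infinite volume, NOT mass gap, NOT `BetaPertH`, NOT Clay.  No `def`, no `sorry`.  PLACEMENT:
`Summits/QuantumFields/BalabanUV/`.  HONEST DEPENDENCY (cell page 1): continuum YM on T⁴ ⇐ BetaPertH ∧ nine spine estimates (0/9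
proved); BetaPertH ⇐ (D1) ∧ (D4) ∧ CAP+tail; G-an2-4 gates asym, D1 and NE2/3/4.
-/

set_option autoImplicit false

open scoped BigOperators Matrix Matrix.Norms.L2Operator
open NormedSpace Finset

namespace Summit.QuantumFields.BalabanUV.T4Continuum.NE3LocalCrudeWPair

open Literature.MathematicalPhysics.QuantumFieldTheory.Balaban1983to89
open B7Prop1Explicit B7Prop2Explicit MatrixLog UnitaryModel
open T4AveragingDeficitWall hiding Site Plane Plaq Bond
open T4AveragingDeficitWallBoundary (gradFluxL1 periodBox)
open T4AveragingDeficitNonAbelian (wallConstLoc abs_deficit_blockWindow_le)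
open AveragingDeficitPeriodicCounting (IsPeriodicDir)
open MinimalActionLevels (avgRadius isUnitaryCfg_rescale_bavg smallField_rescale_bavg)
open MinimalActionRefine (RegularSup)
open NE3EnergySource (fhol_sub_one_le_of_smallField)
open NE3EnergyWeightedShapes (energyNormW energyNormW_nonneg sqrt_curlSq_le_energyNormW weighted_sqrt_dirSq_le_energyNormW)
open NE3HessBounds (bondSq bondSqAt norm_curlAt_le)
open NE3HessContinuity (bondL1 bondL1At bondL1At_sq_le bondL1At_nonneg)
open NE3LocalReadoutSharp (abs_fineAction_vary_sub_le_sharp)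
open NE3LocalCrudePair (windowAction_sub_eq' sum_le_sqrt_card_mul_sqrt sum_curl_sq_eq curlSq_mono sum_bondSq_periodBox_le
  sum_bondSq_mono)
open NE3LocalCrudeWindow (card_blockSites_le card_nbhd_le gradFluxL1_le_of_pointwise gradFluxSq_le_of_pointwise)

noncomputable section

variable {d : ℕ} {n : Type*} [Fintype n] [DecidableEq n] [Nonempty n]

/-! ## §1 The exponential factors of the sharp bracket -/

omit [Fintype n] [DecidableEq n] [Nonempty n] in
/-- `e^α − 1 ≤ α·e^α` (from `1 − α ≤ e^{−α}`). [folklore] -/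
theorem exp_sub_one_le_mul_exp (α : ℝ) : Real.exp α - 1 ≤ α * Real.exp α := by
  have h1 : -α + 1 ≤ Real.exp (-α) := Real.add_one_le_exp (-α)
  have hE : 0 < Real.exp α := Real.exp_pos α
  have h2 : Real.exp α * (-α + 1) ≤ Real.exp α * Real.exp (-α) := mul_le_mul_of_nonneg_left h1 hE.le
  rw [← Real.exp_add, add_neg_cancel, Real.exp_zero] at h2
  linarith

omit [Fintype n] [DecidableEq n] [Nonempty n] in
/-- `0 ≤ e^α − 1` for `0 ≤ α`. [folklore] -/
theorem exp_sub_one_nonneg {α : ℝ} (hα : 0 ≤ α) : 0 ≤ Real.exp α - 1 := by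
  have := Real.add_one_le_exp α
  linarith

omit [Fintype n] [DecidableEq n] [Nonempty n] in
/-- **The closed majorant of the sharp coefficient**: `144(e^α−1)² + 84α(e^α−1) ≤ 228·α²·(e^α)²` (`0 ≤ α`). [folklore] -/
theorem expCoeff_le {α : ℝ} (hα : 0 ≤ α) :
    144 * (Real.exp α - 1) ^ 2 + 84 * α * (Real.exp α - 1) ≤ 228 * α ^ 2 * Real.exp α ^ 2 := by
  have h1 := exp_sub_one_le_mul_exp α
  have h0 := exp_sub_one_nonneg hα
  have hE1 : 1 ≤ Real.exp α := by have := Real.add_one_le_exp α; linarith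
  have hE0 : 0 ≤ Real.exp α := (Real.exp_pos α).le
  -- `(e^α − 1)² ≤ α²(e^α)²`
  have h2 : (Real.exp α - 1) ^ 2 ≤ (α * Real.exp α) ^ 2 := pow_le_pow_left₀ h0 h1 2
  -- `α(e^α − 1) ≤ α²·e^α ≤ α²(e^α)²`
  have h3 : α * (Real.exp α - 1) ≤ α ^ 2 * Real.exp α ^ 2 := by
    have h4 : α * (Real.exp α - 1) ≤ α * (α * Real.exp α) := mul_le_mul_of_nonneg_left h1 hα
    have h5 : α * (α * Real.exp α) = α ^ 2 * Real.exp α := by ring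
    have h6 : α ^ 2 * Real.exp α ≤ α ^ 2 * Real.exp α ^ 2 := by
      have : Real.exp α ≤ Real.exp α ^ 2 := by nlinarith
      exact mul_le_mul_of_nonneg_left this (sq_nonneg α)
    linarith
  nlinarith

/-! ## §2 The sharp read-out in closed form -/

/-- **THE SHARP LOCAL ACTION READ-OUT, CLOSED FORM**: for unitary `V` whose plaquette variables on the window `W` are within `a`
of `1` and a skew direction `X` with `‖X(b)‖ ≤ α` everywhere,
`|A_W(V e^X) − A_W(V)| ≤ a·Σ_{p∈W}‖(d_V X)(p)‖ + Σ_{p∈W}‖(d_V X)(p)‖² + (7a/2 + 14α + 228α²(e^α)²)·Σ_{p∈W} bondSq X p` —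
E-READOUT♯ (`abs_fineAction_vary_sub_le_sharp`) with `bondL1² ≤ 4·bondSq`, `‖(d_V X)(p)‖ ≤ bondL1 ≤ 4α` and §1. [folklore] -/
theorem abs_fineAction_vary_sub_le_closed {V : Site d → Fin d → (Matrix n n ℂ)ˣ} (hV : IsUnitaryCfg V)
    {X : Site d → Fin d → Matrix n n ℂ} (hX : IsSkewDir X) {α : ℝ} (hα : 0 ≤ α) (hXα : ∀ x κ, ‖X x κ‖ ≤ α)
    (W : Finset (T4AveragingDeficitWall.Plaq d)) {a : ℝ}
    (ha : ∀ p ∈ W, ‖((fhol V p : (Matrix n n ℂ)ˣ) : Matrix n n ℂ) - 1‖ ≤ a) :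
    |fineAction (vary V X 1) W - fineAction V W|
      ≤ a * ∑ p ∈ W, ‖curl V X p‖ + ∑ p ∈ W, ‖curl V X p‖ ^ 2
        + (7 / 2 * a + 14 * α + 228 * α ^ 2 * Real.exp α ^ 2) * ∑ p ∈ W, bondSq X p := by
  have hsharp := abs_fineAction_vary_sub_le_sharp hV hX hXα W ha
  have hE0 := exp_sub_one_nonneg hα
  have hC := expCoeff_le hα
  -- per plaquette
  have hpt : ∀ p ∈ W, ‖curl V X p‖ ^ 2 + 36 * (Real.exp α - 1) ^ 2 * bondL1 X p ^ 2
        + 7 / 2 * (a + ‖curl V X p‖ + 24 * α * (Real.exp α - 1)) * bondSq X p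
      ≤ ‖curl V X p‖ ^ 2 + (7 / 2 * a + 14 * α + 228 * α ^ 2 * Real.exp α ^ 2) * bondSq X p := by
    intro p _
    have hB0 : 0 ≤ bondSq X p := by unfold NE3HessBounds.bondSq NE3HessBounds.bondSqAt; positivity
    have hL1sq : bondL1 X p ^ 2 ≤ 4 * bondSq X p := bondL1At_sq_le X p.1 p.2.1.1 p.2.1.2
    -- `‖curl‖ ≤ bondL1 ≤ 4α`
    have hcurl : ‖curl V X p‖ ≤ 4 * α := by
      have h1 : ‖curl V X p‖ ≤ bondL1 X p := norm_curlAt_le hV X p.1 p.2.1.1 p.2.1.2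
      have h2 : bondL1 X p ≤ 4 * α := by
        unfold NE3HessContinuity.bondL1 NE3HessContinuity.bondL1At
        linarith [hXα p.1 p.2.1.1, hXα (p.1 + e p.2.1.1) p.2.1.2, hXα (p.1 + e p.2.1.2) p.2.1.1, hXα p.1 p.2.1.2]
      exact h1.trans h2
    have t1 : 36 * (Real.exp α - 1) ^ 2 * bondL1 X p ^ 2 ≤ 144 * (Real.exp α - 1) ^ 2 * bondSq X p := by
      have := mul_le_mul_of_nonneg_left hL1sq (by positivity : (0 : ℝ) ≤ 36 * (Real.exp α - 1) ^ 2)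
      linarith
    have t2 : 7 / 2 * (a + ‖curl V X p‖ + 24 * α * (Real.exp α - 1)) * bondSq X p
        ≤ 7 / 2 * (a + 4 * α + 24 * α * (Real.exp α - 1)) * bondSq X p := by
      refine mul_le_mul_of_nonneg_right ?_ hB0
      linarith
    have t3 : (144 * (Real.exp α - 1) ^ 2 + 84 * α * (Real.exp α - 1)) * bondSq X p
        ≤ 228 * α ^ 2 * Real.exp α ^ 2 * bondSq X p := mul_le_mul_of_nonneg_right hC hB0
    nlinarith
  have hsum := Finset.sum_le_sum hpt
  have hsplit : ∑ p ∈ W, (‖curl V X p‖ ^ 2 + (7 / 2 * a + 14 * α + 228 * α ^ 2 * Real.exp α ^ 2) * bondSq X p)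
      = ∑ p ∈ W, ‖curl V X p‖ ^ 2 + (7 / 2 * a + 14 * α + 228 * α ^ 2 * Real.exp α ^ 2) * ∑ p ∈ W, bondSq X p := by
    rw [Finset.sum_add_distrib, Finset.mul_sum]
  linarith

/-! ## §3 The two-level window read-out with the sharp bracket, T-E orientation -/

/-- **THE TWO-LEVEL LOCAL ACTION READ-OUT WITH THE SHARP BRACKET**: for `L ≥ 1`, `U_B` unitary in `SmallField U_B a_B` with
`512(d+1)(d+4)L²a_B ≤ 1`, `W = rescale L (bavg L U_B)` unitary with plaquettes within `a_W` of `1` on `Y × planes`, a skew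
direction `Z` with `‖Z(b)‖ ≤ α` (`α ≥ 0`) and a site gauge `u` with `gaugeAct u U_A = vary W Z 1`:
`|L^{d−4}·A_Y(U_A) − A_{B(Y)}(U_B)| ≤ wallConstLoc·(a_B·‖∇F‖_{ℓ¹} + ‖∇F‖²_{ℓ²} + a_B³·#Y)(U_B on N_{2L}(B(Y)))
  + L^{d−4}·(a_W·Σ_{Y×pl}‖d_W Z‖ + Σ_{Y×pl}‖d_W Z‖² + (7a_W/2 + 14α + 228α²(e^α)²)·Σ_{Y×pl} bondSq Z)`. [folklore] -/
theorem abs_windowAction_sub_le_sharp' (L : ℕ) (hL : 1 ≤ L) {UB UA : Site d → Fin d → (Matrix n n ℂ)ˣ}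
    (hUB : IsUnitaryCfg UB) (hW : IsUnitaryCfg (rescale L (bavg L UB))) {aB aW : ℝ} (haB : 0 ≤ aB)
    (hsmall : 512 * (d + 1) * (d + 4) * (L : ℝ) ^ 2 * aB ≤ 1) (hUBa : SmallField UB aB)
    {Z : Site d → Fin d → Matrix n n ℂ} (hZ : IsSkewDir Z) {α : ℝ} (hα : 0 ≤ α) (hZα : ∀ x κ, ‖Z x κ‖ ≤ α)
    {u : Site d → (Matrix n n ℂ)ˣ} (hrep : gaugeAct u UA = vary (rescale L (bavg L UB)) Z 1) (Y : Finset (Site d))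
    (haWp : ∀ p ∈ Y ×ˢ (Finset.univ : Finset (T4AveragingDeficitWall.Plane d)),
      ‖((fhol (rescale L (bavg L UB)) p : (Matrix n n ℂ)ˣ) : Matrix n n ℂ) - 1‖ ≤ aW) :
    |(L : ℝ) ^ ((d : ℤ) - 4) * fineAction UA (Y ×ˢ Finset.univ) - fineAction UB (blockSites L Y ×ˢ Finset.univ)|
      ≤ wallConstLoc d L * (aB * gradFluxL1 UB (nbhd (2 * L) (blockSites L Y))
            + gradFluxSq UB (nbhd (2 * L) (blockSites L Y)) + aB ^ 3 * Y.card)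
        + (L : ℝ) ^ ((d : ℤ) - 4) * (aW * ∑ p ∈ Y ×ˢ Finset.univ, ‖curl (rescale L (bavg L UB)) Z p‖
            + ∑ p ∈ Y ×ˢ Finset.univ, ‖curl (rescale L (bavg L UB)) Z p‖ ^ 2
            + (7 / 2 * aW + 14 * α + 228 * α ^ 2 * Real.exp α ^ 2) * ∑ p ∈ Y ×ˢ Finset.univ, bondSq Z p) := by
  rw [windowAction_sub_eq' L hrep Y]
  have hD := abs_deficit_blockWindow_le L hL hUB haB hsmall hUBa Y
  have hA := abs_fineAction_vary_sub_le_closed hW hZ hα hZα (Y ×ˢ Finset.univ) haWp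
  have hw : 0 ≤ (L : ℝ) ^ ((d : ℤ) - 4) := zpow_nonneg (Nat.cast_nonneg L) _
  have hA' : |(L : ℝ) ^ ((d : ℤ) - 4)
      * (fineAction (vary (rescale L (bavg L UB)) Z 1) (Y ×ˢ Finset.univ)
          - fineAction (rescale L (bavg L UB)) (Y ×ˢ Finset.univ))|
      ≤ (L : ℝ) ^ ((d : ℤ) - 4) * (aW * ∑ p ∈ Y ×ˢ Finset.univ, ‖curl (rescale L (bavg L UB)) Z p‖
            + ∑ p ∈ Y ×ˢ Finset.univ, ‖curl (rescale L (bavg L UB)) Z p‖ ^ 2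
            + (7 / 2 * aW + 14 * α + 228 * α ^ 2 * Real.exp α ^ 2) * ∑ p ∈ Y ×ˢ Finset.univ, bondSq Z p) := by
    rw [abs_mul, abs_of_nonneg hw]
    exact mul_le_mul_of_nonneg_left hA hw
  exact (abs_add_le _ _).trans (add_le_add hD hA')

/-! ## §4 The direction terms against the WEIGHTED energy norm -/

omit [Nonempty n] in
/-- `curlSq ≤ energyNormW²`. [folklore] -/
theorem curlSq_le_energyNormW_sq (L k : ℕ) (W : Site d → Fin d → (Matrix n n ℂ)ˣ) (Z : Site d → Fin d → Matrix n n ℂ)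
    (F : Finset (Site d)) : curlSq W Z F ≤ energyNormW L k W Z F ^ 2 := by
  unfold NE3EnergyWeightedShapes.energyNormW
  have hC : 0 ≤ curlSq W Z F := by unfold curlSq; positivity
  have hD : 0 ≤ dirSq Z F := by unfold dirSq; positivity
  rw [Real.sq_sqrt (by positivity)]
  nlinarith [sq_nonneg (((L : ℝ) ^ k)⁻¹)]

omit [Nonempty n] in
/-- `dirSq ≤ (L^k)²·energyNormW²` (`L ≥ 1`): the bond term carries the weight `(L^k)⁻²`. [folklore] -/
theorem dirSq_le_pow_sq_mul_energyNormW_sq {L : ℕ} (hL : 1 ≤ L) (k : ℕ) (W : Site d → Fin d → (Matrix n n ℂ)ˣ)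
    (Z : Site d → Fin d → Matrix n n ℂ) (F : Finset (Site d)) :
    dirSq Z F ≤ ((L : ℝ) ^ k) ^ 2 * energyNormW L k W Z F ^ 2 := by
  unfold NE3EnergyWeightedShapes.energyNormW
  have hC : 0 ≤ curlSq W Z F := by unfold curlSq; positivity
  have hD : 0 ≤ dirSq Z F := by unfold dirSq; positivity
  rw [Real.sq_sqrt (by positivity)]
  have hs : (0 : ℝ) < (L : ℝ) ^ k := pow_pos (by exact_mod_cast (by omega : 0 < L)) k
  have e : ((L : ℝ) ^ k) ^ 2 * ((((L : ℝ) ^ k)⁻¹) ^ 2 * dirSq Z F) = dirSq Z F := by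
    field_simp
  nlinarith [sq_nonneg ((L : ℝ) ^ k)]

omit [Nonempty n] in
/-- **THE CURL TERM AGAINST THE WEIGHTED NORM**: for `Y ⊆ F`, `Σ_{p∈Y×pl}‖(d_W Z)(p)‖ ≤ √(#Y·#Pl)·energyNormW L k W Z F`. [folklore] -/
theorem sum_norm_curl_le_energyNormW (L k : ℕ) (W : Site d → Fin d → (Matrix n n ℂ)ˣ) (Z : Site d → Fin d → Matrix n n ℂ)
    {Y F : Finset (Site d)} (h : Y ⊆ F) :
    ∑ p ∈ Y ×ˢ (Finset.univ : Finset (T4AveragingDeficitWall.Plane d)), ‖curl W Z p‖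
      ≤ Real.sqrt (Y.card * Fintype.card (T4AveragingDeficitWall.Plane d)) * energyNormW L k W Z F := by
  have h1 := sum_le_sqrt_card_mul_sqrt (Y ×ˢ (Finset.univ : Finset (T4AveragingDeficitWall.Plane d)))
    (f := fun p => ‖curl W Z p‖) (fun _ _ => norm_nonneg _)
  rw [sum_curl_sq_eq, Finset.card_product, Finset.card_univ] at h1
  refine h1.trans ?_
  push_cast
  refine mul_le_mul_of_nonneg_left ?_ (Real.sqrt_nonneg _)
  exact (Real.sqrt_le_sqrt (curlSq_mono W Z h)).trans (sqrt_curlSq_le_energyNormW L k W Z F)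

omit [Nonempty n] in
/-- **ALL THREE DIRECTION TERMS AGAINST THE WEIGHTED NORM**: for `L ≥ 1`, `Y ⊆ periodBox M`, `Z` `M`-periodic (`M ≥ 1`), `a, κ ≥ 0`
and `E = energyNormW L k W Z (periodBox M)`:
`a·Σ_{Y×pl}‖d_W Z‖ + Σ_{Y×pl}‖d_W Z‖² + κ·Σ_{Y×pl} bondSq Z ≤ a·√(#Y·#Pl)·E + E² + κ·4#Pl·(L^k)²·E²`. [folklore] -/
theorem dirTermsW_le {L : ℕ} (hL : 1 ≤ L) (k : ℕ) (W : Site d → Fin d → (Matrix n n ℂ)ˣ) {Z : Site d → Fin d → Matrix n n ℂ}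
    (M : ℕ) (hM : 1 ≤ M) (hZ : IsPeriodicDir Z (M : ℤ)) {Y : Finset (Site d)} (hY : Y ⊆ periodBox M) {a κ : ℝ}
    (ha : 0 ≤ a) (hκ : 0 ≤ κ) :
    a * ∑ p ∈ Y ×ˢ (Finset.univ : Finset (T4AveragingDeficitWall.Plane d)), ‖curl W Z p‖
        + ∑ p ∈ Y ×ˢ (Finset.univ : Finset (T4AveragingDeficitWall.Plane d)), ‖curl W Z p‖ ^ 2
        + κ * ∑ p ∈ Y ×ˢ (Finset.univ : Finset (T4AveragingDeficitWall.Plane d)), bondSq Z p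
      ≤ a * (Real.sqrt (Y.card * Fintype.card (T4AveragingDeficitWall.Plane d)) * energyNormW L k W Z (periodBox M))
        + energyNormW L k W Z (periodBox M) ^ 2
        + κ * (4 * Fintype.card (T4AveragingDeficitWall.Plane d) * (((L : ℝ) ^ k) ^ 2
            * energyNormW L k W Z (periodBox M) ^ 2)) := by
  have h1 := sum_norm_curl_le_energyNormW L k W Z hY
  have h2 : ∑ p ∈ Y ×ˢ (Finset.univ : Finset (T4AveragingDeficitWall.Plane d)), ‖curl W Z p‖ ^ 2
      ≤ energyNormW L k W Z (periodBox M) ^ 2 := by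
    rw [sum_curl_sq_eq]
    exact (curlSq_mono W Z hY).trans (curlSq_le_energyNormW_sq L k W Z _)
  have h3 := (sum_bondSq_mono Z hY).trans (sum_bondSq_periodBox_le M hM hZ)
  have h4 := dirSq_le_pow_sq_mul_energyNormW_sq hL k W Z (periodBox M)
  have hPl : (0 : ℝ) ≤ 4 * Fintype.card (T4AveragingDeficitWall.Plane d) := by positivity
  have h5 := h3.trans (mul_le_mul_of_nonneg_left h4 hPl)
  have h6 := mul_le_mul_of_nonneg_left h5 hκ
  have h7 := mul_le_mul_of_nonneg_left h1 ha
  linarith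

/-! ## §5 The pair bound with all inputs named, weighted currency -/

/-- **THE TWO-LEVEL LOCAL ACTION READ-OUT FROM SUP-FORM REGULARITY, A SUP BOUND ON THE DIRECTION, AND THE WEIGHTED ENERGY NORM.**
For `L ≥ 1`, a run-(k+1) configuration `U_B` with `RegularSup d L N b c (k+1)` (`b, c ≥ 0`, `512(d+1)(d+4)L²·b ≤ 1`), its
rescaled average `W = rescale L (bavg L U_B)`, a configuration `U_A`, a site gauge `u` and an `M`-periodic skew direction `Z`
(`M ≥ 1`) with `gaugeAct u U_A = vary W Z 1` and `‖Z(b)‖ ≤ α` (`α ≥ 0`), a weight level `j`, and a finite window `Y ⊆ periodBox M`: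
`|L^{d−4}·A_Y(U_A) − A_{B(Y)}(U_B)| ≤ wallConstLoc·#Y·(L^d(4L+1)^d·d·#Pl·(a_B·γ + γ²) + a_B³)
   + L^{d−4}·(a_W·√(#Y·#Pl)·E + E² + (7a_W/2 + 14α + 228α²(e^α)²)·4#Pl·(L^j)²·E²)`
with `a_B = b/(L^{k+1})²`, `γ = c/(L^{k+1})³`, `a_W = avgRadius d L a_B`, `E = energyNormW L j W Z (periodBox M)`. [folklore] -/
theorem abs_windowAction_sub_le_of_regularSup_sharp (L : ℕ) (hL : 1 ≤ L) {N k : ℕ} {b c : ℝ} (hb : 0 ≤ b) (hc : 0 ≤ c)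
    (hbs : 512 * (d + 1) * (d + 4) * (L : ℝ) ^ 2 * b ≤ 1)
    {UB UA : Site d → Fin d → (Matrix n n ℂ)ˣ} (hreg : RegularSup d L N b c (k + 1) UB)
    {Z : Site d → Fin d → Matrix n n ℂ} (hZ : IsSkewDir Z) {M : ℕ} (hM : 1 ≤ M) (hZp : IsPeriodicDir Z (M : ℤ))
    {α : ℝ} (hα : 0 ≤ α) (hZα : ∀ x κ, ‖Z x κ‖ ≤ α)
    {u : Site d → (Matrix n n ℂ)ˣ} (hrep : gaugeAct u UA = vary (rescale L (bavg L UB)) Z 1) (j : ℕ)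
    {Y : Finset (Site d)} (hY : Y ⊆ periodBox M) :
    |(L : ℝ) ^ ((d : ℤ) - 4) * fineAction UA (Y ×ˢ Finset.univ) - fineAction UB (blockSites L Y ×ˢ Finset.univ)|
      ≤ wallConstLoc d L * (Y.card * ((L : ℝ) ^ d * ((2 * (2 * L) + 1 : ℕ) : ℝ) ^ d
            * (d * (Fintype.card (T4AveragingDeficitWall.Plane d)
              * ((b / ((L : ℝ) ^ (k + 1)) ^ 2) * (c / ((L : ℝ) ^ (k + 1)) ^ 3) + (c / ((L : ℝ) ^ (k + 1)) ^ 3) ^ 2)))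
            + (b / ((L : ℝ) ^ (k + 1)) ^ 2) ^ 3))
        + (L : ℝ) ^ ((d : ℤ) - 4) * (avgRadius d L (b / ((L : ℝ) ^ (k + 1)) ^ 2)
            * (Real.sqrt (Y.card * Fintype.card (T4AveragingDeficitWall.Plane d))
              * energyNormW L j (rescale L (bavg L UB)) Z (periodBox M))
          + energyNormW L j (rescale L (bavg L UB)) Z (periodBox M) ^ 2
          + (7 / 2 * avgRadius d L (b / ((L : ℝ) ^ (k + 1)) ^ 2) + 14 * α + 228 * α ^ 2 * Real.exp α ^ 2)
            * (4 * Fintype.card (T4AveragingDeficitWall.Plane d) * (((L : ℝ) ^ j) ^ 2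
              * energyNormW L j (rescale L (bavg L UB)) Z (periodBox M) ^ 2))) := by
  have hL1 : (1 : ℝ) ≤ L := by exact_mod_cast hL
  -- the scales of level k+1
  set aB : ℝ := b / ((L : ℝ) ^ (k + 1)) ^ 2 with haBdef
  set γ : ℝ := c / ((L : ℝ) ^ (k + 1)) ^ 3 with hγdef
  have haB0 : 0 ≤ aB := by positivity
  have hγ0 : 0 ≤ γ := by positivity
  have hs1 : (1 : ℝ) ≤ ((L : ℝ) ^ (k + 1)) ^ 2 := one_le_pow₀ (one_le_pow₀ hL1)
  have haBb : aB ≤ b := div_le_self hb hs1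
  have hsmall : 512 * (d + 1) * (d + 4) * (L : ℝ) ^ 2 * aB ≤ 1 := by
    have h0 : (0 : ℝ) ≤ 512 * (d + 1) * (d + 4) * (L : ℝ) ^ 2 := by positivity
    exact (mul_le_mul_of_nonneg_left haBb h0).trans hbs
  -- `W` is unitary and a small field of radius `avgRadius aB`
  have hW : IsUnitaryCfg (rescale L (bavg L UB)) := isUnitaryCfg_rescale_bavg L hL hreg.unitary haB0 hsmall hreg.small
  have hWa : SmallField (rescale L (bavg L UB)) (avgRadius d L aB) :=
    smallField_rescale_bavg L hL hreg.unitary haB0 hsmall hreg.small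
  have haW0 : 0 ≤ avgRadius d L aB := by unfold MinimalActionLevels.avgRadius; positivity
  -- §3's read-out
  have hpair := abs_windowAction_sub_le_sharp' L hL hreg.unitary hW haB0 hsmall hreg.small hZ hα hZα hrep Y
    (fhol_sub_one_le_of_smallField hWa _)
  -- the window terms (verbatim (52S))
  set S := nbhd (2 * L) (blockSites L Y) with hSdef
  have hcardS : (S.card : ℝ) ≤ Y.card * ((L : ℝ) ^ d * ((2 * (2 * L) + 1 : ℕ) : ℝ) ^ d) := by
    have h1 := card_nbhd_le (d := d) (2 * L) (blockSites L Y)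
    have h2 := card_blockSites_le (d := d) L Y
    have h3 : (0 : ℝ) ≤ ((2 * (2 * L) + 1 : ℕ) : ℝ) ^ d := by positivity
    calc (S.card : ℝ) ≤ (blockSites L Y).card * ((2 * (2 * L) + 1 : ℕ) : ℝ) ^ d := h1
      _ ≤ Y.card * (L : ℝ) ^ d * ((2 * (2 * L) + 1 : ℕ) : ℝ) ^ d := mul_le_mul_of_nonneg_right h2 h3
      _ = Y.card * ((L : ℝ) ^ d * ((2 * (2 * L) + 1 : ℕ) : ℝ) ^ d) := by ring
  have hG1 := (gradFluxL1_le_of_pointwise hreg.grad S).trans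
    (mul_le_mul_of_nonneg_right hcardS (by positivity))
  have hG2 := (gradFluxSq_le_of_pointwise hreg.grad S).trans
    (mul_le_mul_of_nonneg_right hcardS (by positivity))
  -- the direction terms against the weighted norm
  have hκ0 : 0 ≤ 7 / 2 * avgRadius d L aB + 14 * α + 228 * α ^ 2 * Real.exp α ^ 2 := by positivity
  have hdir := dirTermsW_le hL j (rescale L (bavg L UB)) M hM hZp hY haW0 hκ0
  have hw : 0 ≤ (L : ℝ) ^ ((d : ℤ) - 4) := zpow_nonneg (Nat.cast_nonneg L) _
  have hWc : 0 ≤ wallConstLoc d L := by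
    unfold T4AveragingDeficitNonAbelian.wallConstLoc
    have := T4AveragingDeficitNonAbelian.wallConstNA_nonneg (d := d) L
    positivity
  -- assemble
  refine hpair.trans (add_le_add ?_ (mul_le_mul_of_nonneg_left hdir hw))
  refine mul_le_mul_of_nonneg_left ?_ hWc
  have e1 : aB * (↑Y.card * ((L : ℝ) ^ d * ((2 * (2 * L) + 1 : ℕ) : ℝ) ^ d)
        * (↑d * (↑(Fintype.card (T4AveragingDeficitWall.Plane d)) * γ)))
      + ↑Y.card * ((L : ℝ) ^ d * ((2 * (2 * L) + 1 : ℕ) : ℝ) ^ d)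
        * (↑d * (↑(Fintype.card (T4AveragingDeficitWall.Plane d)) * γ ^ 2)) + aB ^ 3 * ↑Y.card
      = ↑Y.card * ((L : ℝ) ^ d * ((2 * (2 * L) + 1 : ℕ) : ℝ) ^ d
        * (↑d * (↑(Fintype.card (T4AveragingDeficitWall.Plane d)) * (aB * γ + γ ^ 2))) + aB ^ 3) := by ring
  rw [← e1]
  have h3 := mul_le_mul_of_nonneg_left hG1 haB0
  linarith

end

end Summit.QuantumFields.BalabanUV.T4Continuum.NE3LocalCrudeWPair
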